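import Summits.CriticalPhenomena.PercolationContinuityZ3.Theses.PercNonProliferation
import Summits.CriticalPhenomena.PercolationContinuityZ3.Theorems.NonProliferation.Negative.AboveSix
import Literature.Probability.Percolation.RSW
import Summits.CriticalPhenomena.PercolationContinuityZ3.Theorems.PercNonProliferationNonProliferationStubCellUnionBound
import Summits.CriticalPhenomena.PercolationContinuityZ3.Theorems.PercNonProliferationNonProliferationStubBoundaryGrid
import Summits.CriticalPhenomena.PercolationContinuityZ3.Theorems.PercNonProliferationNonProliferationStubInnerCellCount
import Summits.CriticalPhenomena.PercolationContinuityZ3.Theorems.PercNonProliferationNonProliferationStubInnerTwoArmDecay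
import Summits.CriticalPhenomena.PercolationContinuityZ3.Theorems.PercNonProliferationNonProliferationStubLayerCake
import Summits.CriticalPhenomena.PercolationContinuityZ3.Theorems.PercNonProliferationNonProliferationStubMidSphereCrossers
import Summits.CriticalPhenomena.PercolationContinuityZ3.Theorems.PercNonProliferationNonProliferationStubMultiCrossAtShift
import Summits.CriticalPhenomena.PercolationContinuityZ3.Theorems.PercNonProliferationNonProliferationRatioDichotomy

/-!
# Line `boundary-pinning` (payload slug `Sketch`) — checked skeleton for the crux `NonProliferation`
# (stmt-CriticalPhenomena-4444, route `PercNonProliferation`, rank 2) — lead c1 gen 4, lead c2 gen 5 (2026-08-16)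

Crux (fixed, by name): `PercNonProliferation.NonProliferation` —
`∃ M c, 0 < c ∧ ∃ᶠ n, c ≤ P_{p_c(ℤ³)}(N_n ≤ M)`, where `N_n` is the number of clusters of the open
graph INDUCED on the free box `B(2n)` meeting both `B(n)` and `∂ⁱⁿB(2n)`, typed through
representatives: `{N_n ≤ M} = (repEvent 3 M n)ᶜ`
(`Theorems.NonProliferation.Negative.nonProliferation_iff`, `Iff.rfl`).

THE LINE (idea card `Cruxes/NonProliferation/Ideas/boundary-pinning.md`, ideator 5's sketch
`Cruxes/NonProliferation/Sketch_ideator5.lean`, triage `TRIAGE-r2-1.md`, `TRIAGE-r2-2.md`: pass ×2).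
Every crosser touches the FREE outer boundary `∂ⁱⁿB(2n)`, a 2-dimensional grid surface. Cut it into
`≤ 600/ε²` cells of coordinate-diameter `< ⌊εn⌋` (`stub_boundaryGrid`) and PIGEONHOLE: `N_n ≥ #cells + 1`
forces two box-DISTINCT crossers to touch the same cell `Q`, i.e. the boundary two-distinct-cluster
event `faceTwoArm n Q` (`stub_cellUnionBound`, union bound). If that event has probability `o(ε²)` per
cell as `ε → 0`, frequently in `n` (`stub_boundaryCellTwoArm` — OPEN, the only place where `d = 3`
enters; predicted exponent `a₂^∂ = d = 3 > 2 = dim ∂B`, measured `a_cell → 3.0`, kit j013488/j014710),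
then `P(N_n ≥ ⌊600/ε²⌋ + 1) ≤ 1/2` frequently: the crux with `M = ⌊600/ε²⌋`, `c = 1/2`
(`NonProliferation_of`, kernel-checked below).

SUPPORT (triage-endorsed, unconditional, same bookkeeping on the INNER sphere `∂ⁱⁿB(n)`):
`PowerCap` — `E_{p_c} N_n ≤ C n^{2-β}` for some `β > 0` — from the in-tree DKT/Cerf uniqueness zone
(`Literature.Probability.Percolation.dkt_prop1`), cut into `stub_innerCellCount` (deterministic: last exit
through `∂ⁱⁿB(n)`, cells, pigeonhole), `stub_innerTwoArmDecay` (two box-distinct crossers through one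
cell of side `⌊n^α⌋` violate the translated uniqueness zone: probability `≤ n^{-α}`) and `stub_layerCake`
(measure glue `Σ_k P(N ≥ k+1) ≤ E[pointwise majorant]`); composed in `powerCap_of`.

Disproof used (`Cruxes/NonProliferation/Disproof.lean`, tree copy of 05:53Z, re-read 10:50Z; landed
`Negative/{AboveSix,MZeroSlice}`): `nonProliferation_false_without_dimThree` is honoured at the single open
stub (`stub_boundaryCellTwoArm` is `d = 3`-specific; its `d ≥ 7` analogue is false under (t-c) since
there `P(repEvent d M n) → 1` for every `M` while the reduction is dimension-free); the `M = 0` slice is not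
used (the line tolerates `u_n(p_c) → 1`); `-- Targets`: none posted.

Registered stubs — gen 2 status (wave 1, 2026-08-16 11:15–13:00Z: FIVE of six LANDED as
`Theorems/PercNonProliferationNonProliferationStub*.lean`, `--supports stmt-CriticalPhenomena-4444`; below they are
one-line aliases of the landed theorems, their statements spelled out verbatim; the ONLY remaining `sorry` is
`stub_boundaryCellTwoArm`):
* `stub_cellUnionBound`   — LANDED p101623 (pigeonhole + union bound, every `d`, `p`).
* `stub_boundaryGrid`     — LANDED p102171 (grid cells of side `s` on `∂ⁱⁿΛ_R`, `≤ 2d(2R/s+2)^{d-1}` of them).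
* `stub_boundaryCellTwoArm` — OPEN (hardest; the lead's): `o(ε²)` boundary two-distinct-cluster cell decay.
* `stub_innerCellCount`   — LANDED p101291 (deterministic count behind `PowerCap`).
* `stub_innerTwoArmDecay` — LANDED p103479 (`dkt_prop1` + translation + first exit).
* `stub_layerCake`        — LANDED p101427 (finite layer cake).
Consequently `PowerCap` (`powerCap`) holds UNCONDITIONALLY (standard axioms) and `NonProliferation_proof`
depends on the single `sorryAx` of `stub_boundaryCellTwoArm`.

LANDED COMPOSITIONS (lead, 13:45Z): `Theorems/PercNonProliferationNonProliferationPowerCap.lean` (p106058: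
`expected_numSpanning_le_rpow`, the unconditional `PowerCap`) and
`Theorems/PercNonProliferationNonProliferationOfBoundaryCellTwoArm.lean` (p106091:
`nonProliferation_of_boundaryCellTwoArm` = this file's `NonProliferation_of` with the two landed stubs inlined,
and `boundaryCellTwoArm_of_exp`); calibration `Theorems/PercNonProliferationNonProliferationBoundaryCellTwoArmAboveSix.lean`
(p106638: the stub's `d`-dimensional analogue fails for `d ≥ 7` under (t-c)). They are not imported here only to
keep the skeleton independent of the farm's build order; the proofs below are the same texts.

GEN 3 (14:30Z): BULK SIBLING added (triage r2-2 merged `avoidance-cost-covering ≈ boundary-pinning`: "one line with two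
interchangeable open stubs"): `NonProliferation_of_bulk : stub_midSphereCrossers → stub_multiCrossAt_shift →
stub_threeCrosserDecay → crux` (kernel-checked), with `stub_midSphereCrossers` (deterministic, provable),
`stub_multiCrossAt_shift` (translation invariance, provable) delegated in wave 2 and `stub_threeCrosserDecay` OPEN
(three box-distinct crossers at large ratio: `k² · P → 0`). Open obligations now: `stub_boundaryCellTwoArm` (wall) and
`stub_threeCrosserDecay` (bulk) — EITHER closes the crux; plus the two provable bulk stubs in flight.

GEN 4 (lead c1, 20:09Z): both provable bulk stubs LANDED (p107588 `stub_midSphereCrossers`, p107378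
`stub_multiCrossAt_shift`); bulk reduction `Theorems/…OfThreeCrosserDecay.lean` (p124279) and its calibration
`…ThreeCrosserDecayAboveSix.lean` (p124280) landed. Sorries = the two `d = 3` inputs only.

GEN 5 (lead c2, 2026-08-16 20:45Z): the RATIO DICHOTOMY, landed as
`Theorems/PercNonProliferationNonProliferationRatioDichotomy.lean` (p124993, `--supports`): BK at GENERAL ratio
(`RatioDichotomy.real_multiCross_le_pow`: `(r+1)` box-distinct crossers of `B(L) ∖ B(m)` have probability
`≤ P(B(m) ↔ ∂ⁱⁿB(L) in B(L))^{r+1}`, from the in-tree `setOf_distinctClusters_subset_disjointOccurrencePow`) feeds the bulk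
covering in its weakest, frequently-in-`m` form (`nonProliferation_of_frequently_multiCross`, any multiplicity `r`), so
that BLOCKING of the critical annulus with probability `≥ δ` at ONE ratio `k ≥ 2` along ANY subsequence gives the crux
(`nonProliferation_of_frequently_blocked`; third composition `repEvent_compl_frequently_of_blocking` below). Its hypothesis
`FrequentBlocking` is NOT registered as a stub: it is (verbatim up to the spelling of "i.o.") the TARGET
`PercBudgetLadder.CritAnnulusBlockedIO` (stmt-CriticalPhenomena-5247) of a sibling route, which closes the summit by
itself (`SufficesTarget` + `BlockingVanishesOfTheta`, proved) — bridge `nonProliferation_of_critAnnulusBlockedIO` filed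
separately. What the dichotomy buys THIS line: contrapositively, `¬ crux ⇒` sure crossing at EVERY fixed ratio
(`crossing_tendsto_one_of_not_nonProliferation`, extending the disprover's ratio-2 `Negative/MZeroSlice`), so the two
open stubs need only hold / be attacked in the sure-crossing regime `P_{p_c}(B(m) ↔ ∂ⁱⁿB(km) in B(km)) → 1 ∀ k`
— the regime of the hypothetical jump world, where the route's assembly uses the crux.
-/

noncomputable section

namespace Summit.CriticalPhenomena.PercolationContinuityZ3.Cruxes.NonProliferation.BoundaryPinning

open MeasureTheory Filter Topology
open Literature.Probability.LatticeModels Literature.Probability.Percolation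
open Summit.CriticalPhenomena.PercolationContinuityZ3.Theorems.NonProliferation.Negative
open Summit.CriticalPhenomena.PercolationContinuityZ3.Theses.PercNonProliferation

/-! ## Vocabulary of the line (abbreviations; the registered stubs spell everything out) -/

/-- The critical bond measure on `ℤ^d`. -/
abbrev Pc (d : ℕ) : Measure (BondConfig (Site d)) := bondPercolation (zdGraph d) (criticalProbI d)

/-- **Boundary two-DISTINCT-cluster event at a cell `Q`** (meant for `Q ⊆ ∂ⁱⁿB(2n)`): two points
`u, v ∈ Q`, each joined inside `B(2n)` to the inner box `B(n)`, NOT joined to each other inside `B(2n)`. -/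
def faceTwoArm (d n : ℕ) (Q : Finset (Site d)) : Set (BondConfig (Site d)) :=
  {ω | ∃ u ∈ Q, ∃ v ∈ Q, (∃ a ∈ box d n, ω ∈ openConnIn (↑(box d (2 * n)) : Set (Site d)) u a) ∧
    (∃ b ∈ box d n, ω ∈ openConnIn (↑(box d (2 * n)) : Set (Site d)) v b) ∧
    ω ∉ openConnIn (↑(box d (2 * n)) : Set (Site d)) u v}

/-- **Inner two-DISTINCT-crosser event at a cell `Q`** (meant for `Q ⊆ ∂ⁱⁿB(n)`): two points `u, v ∈ Q`,
each joined inside `B(2n)` to the outer boundary `∂ⁱⁿB(2n)`, NOT joined to each other inside `B(2n)`. -/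
def innerTwoArm (d n : ℕ) (Q : Finset (Site d)) : Set (BondConfig (Site d)) :=
  {ω | ∃ u ∈ Q, ∃ v ∈ Q,
    (∃ a ∈ innerBoundary (zdGraph d) (box d (2 * n)), ω ∈ openConnIn (↑(box d (2 * n)) : Set (Site d)) u a) ∧
    (∃ b ∈ innerBoundary (zdGraph d) (box d (2 * n)), ω ∈ openConnIn (↑(box d (2 * n)) : Set (Site d)) v b) ∧
    ω ∉ openConnIn (↑(box d (2 * n)) : Set (Site d)) u v}

/-- **`PowerCap`**: `E_{p_c(ℤ³)} N_n ≤ C n^{2-β}` for some `β > 0`, with `E N_n = Σ_{k<#B(n)} P(N_n ≥ k+1)`. -/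
def PowerCap : Prop :=
  ∃ β C : ℝ, 0 < β ∧ ∀ n : ℕ, 1 ≤ n →
    ∑ k ∈ Finset.range (box 3 n).card, (bondPercolation (zdGraph 3) (criticalProbI 3)).real (repEvent 3 k n)
      ≤ C * (n : ℝ) ^ (2 - β)

/-! ## Registered stubs (statements) -/

namespace Stubs

/-- `stub_cellUnionBound` (provable now, every `d`, `n`, `p`): if a finite family of cells covers
`∂ⁱⁿB(2n)`, then `P_p(N_n ≥ #cells + 1) ≤ Σ_cells P_p(faceTwoArm n cell)` (pigeonhole on the boundary
endpoints of the representatives' crossing paths, then the union bound). -/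
def stub_cellUnionBound : Prop :=
  ∀ (d n : ℕ) (p : unitInterval) (𝒬 : Finset (Finset (Site d))),
    (∀ y ∈ innerBoundary (zdGraph d) (box d (2 * n)), ∃ Q ∈ 𝒬, y ∈ Q) →
    (bondPercolation (zdGraph d) p).real (repEvent d 𝒬.card n) ≤
      ∑ Q ∈ 𝒬, (bondPercolation (zdGraph d) p).real
        {ω | ∃ u ∈ Q, ∃ v ∈ Q, (∃ a ∈ box d n, ω ∈ openConnIn (↑(box d (2 * n)) : Set (Site d)) u a) ∧
          (∃ b ∈ box d n, ω ∈ openConnIn (↑(box d (2 * n)) : Set (Site d)) v b) ∧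
          ω ∉ openConnIn (↑(box d (2 * n)) : Set (Site d)) u v}

/-- `stub_boundaryGrid` (provable now, every `d`, `R`, `s ≥ 1`): the sphere `∂ⁱⁿΛ_R` is covered by at most
`2d (2R/s + 2)^{d-1}` cells, each a subset of `∂ⁱⁿΛ_R` of coordinate-diameter `< s` and of size `≤ s^d`
(the traces on `∂ⁱⁿΛ_R` of the grid cubes `∏_i [z_i s, (z_i+1) s)`; a cube meeting the face `{x_i = ±R}`
has `z_i = ⌊±R/s⌋`, the other `d-1` indices range over `⌊-R/s⌋ … ⌊R/s⌋`). -/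
def stub_boundaryGrid : Prop :=
  ∀ (d R s : ℕ), 1 ≤ s →
    ∃ 𝒬 : Finset (Finset (Site d)),
      (∀ Q ∈ 𝒬, Q ⊆ innerBoundary (zdGraph d) (box d R)) ∧
      (∀ Q ∈ 𝒬, ∀ u ∈ Q, ∀ v ∈ Q, ∀ i : Fin d, |u i - v i| + 1 ≤ (s : ℤ)) ∧
      (∀ Q ∈ 𝒬, Q.card ≤ s ^ d) ∧
      (∀ y ∈ innerBoundary (zdGraph d) (box d R), ∃ Q ∈ 𝒬, y ∈ Q) ∧
      ((𝒬.card : ℝ) ≤ 2 * d * (2 * (R : ℝ) / s + 2) ^ (d - 1))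

/-- `stub_boundaryCellTwoArm` (OPEN — the `d = 3` input; constant-free cell form of ideator 5's
`BoundaryCellTwoArm`, implied by the exponent form `a > 2`, see `stub_boundaryCellTwoArm_of_exp`):
for every `δ > 0` there is a mesh `ε ∈ (0,1]` such that, for infinitely many `n`, EVERY cell `Q ⊆ ∂ⁱⁿB(2n)` of
coordinate-diameter `≤ εn` carries the boundary two-distinct-cluster event with probability `≤ δ ε²`
(two box-distinct deep clusters essentially never touch the free wall within `εn` of each other:
`P = o(ε²) = o(1/#cells)`). False for `d ≥ 7` under Aizenman's (t-c) (there `P(repEvent d M n) → 1` for every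
`M`, while `stub_cellUnionBound`/`stub_boundaryGrid` are dimension-free), as the disprover's
`nonProliferation_false_without_dimThree` requires of any sufficient condition. -/
def stub_boundaryCellTwoArm : Prop :=
  ∀ δ : ℝ, 0 < δ → ∃ ε : ℝ, 0 < ε ∧ ε ≤ 1 ∧ ∃ᶠ n : ℕ in atTop,
    ∀ Q : Finset (Site 3), Q ⊆ innerBoundary (zdGraph 3) (box 3 (2 * n)) →
      (∀ u ∈ Q, ∀ v ∈ Q, ∀ i : Fin 3, ((|u i - v i| : ℤ) : ℝ) ≤ ε * n) →
      (bondPercolation (zdGraph 3) (criticalProbI 3)).real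
        {ω | ∃ u ∈ Q, ∃ v ∈ Q, (∃ a ∈ box 3 n, ω ∈ openConnIn (↑(box 3 (2 * n)) : Set (Site 3)) u a) ∧
          (∃ b ∈ box 3 n, ω ∈ openConnIn (↑(box 3 (2 * n)) : Set (Site 3)) v b) ∧
          ω ∉ openConnIn (↑(box 3 (2 * n)) : Set (Site 3)) u v} ≤ δ * ε ^ 2

/-- `stub_innerCellCount` (provable now, deterministic, every `d`, `n ≥ 1`, lattice configurations):
if a family of cells covers the inner sphere `∂ⁱⁿB(n)` and there are `k+1` box-distinct crossers, then
`k + 1 ≤ #cells + Σ_cells |cell|·1[innerTwoArm n cell]` (send each representative to the LAST point of its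
crossing path in `B(n)` — a point of `∂ⁱⁿB(n)` joined inside `B(2n)` to `∂ⁱⁿB(2n)` —; these points are pairwise
unjoined, hence distinct; a cell receiving two of them carries `innerTwoArm`, and receives at most `|cell|`). -/
def stub_innerCellCount : Prop :=
  ∀ (d n k : ℕ) (𝒬 : Finset (Finset (Site d))) (ω : BondConfig (Site d)),
    1 ≤ n → ω ⊆ (zdGraph d).edgeSet →
    (∀ y ∈ innerBoundary (zdGraph d) (box d n), ∃ Q ∈ 𝒬, y ∈ Q) →
    ω ∈ repEvent d k n →
    (k + 1 : ℝ) ≤ 𝒬.card + ∑ Q ∈ 𝒬,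
      Set.indicator {ω' : BondConfig (Site d) | ∃ u ∈ Q, ∃ v ∈ Q,
          (∃ a ∈ innerBoundary (zdGraph d) (box d (2 * n)),
            ω' ∈ openConnIn (↑(box d (2 * n)) : Set (Site d)) u a) ∧
          (∃ b ∈ innerBoundary (zdGraph d) (box d (2 * n)),
            ω' ∈ openConnIn (↑(box d (2 * n)) : Set (Site d)) v b) ∧
          ω' ∉ openConnIn (↑(box d (2 * n)) : Set (Site d)) u v}
        (fun _ => (Q.card : ℝ)) ω

/-- `stub_innerTwoArmDecay` (provable now from the in-tree DKT/Cerf uniqueness zone, every `d ≥ 2`):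
there are `α > 0` and `n₁` such that for `n ≥ n₁` every `Q ⊆ B(n)` of coordinate-diameter `≤ ⌊n^α⌋` carries
`innerTwoArm n Q` with probability `≤ n^{-α}` at `p_c(ℤ^d)` (pick `z ∈ Q`; `Q ⊆ z + Λ_{⌊n^α⌋}`, `z + Λ_n ⊆ B(2n)`;
a crossing path from `u ∈ Q` to `∂ⁱⁿB(2n)` reaches `∂ⁱⁿ(z + Λ_n)` inside `z + Λ_n` (first exit); two unjoined such
`u, v` violate `uniqZoneAt z ⌊n^α⌋ n`; translation invariance `real_uniqZoneAt_eq` and `dkt_prop1` with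
`δ = min(p_c, 1 - p_c) > 0`). -/
def stub_innerTwoArmDecay : Prop :=
  ∀ d : ℕ, 2 ≤ d → ∃ α : ℝ, 0 < α ∧ ∃ n₁ : ℕ, ∀ n : ℕ, n₁ ≤ n →
    ∀ Q : Finset (Site d), Q ⊆ box d n →
      (∀ u ∈ Q, ∀ v ∈ Q, ∀ i : Fin d, |u i - v i| ≤ ((⌊(n : ℝ) ^ α⌋₊ : ℕ) : ℤ)) →
      (bondPercolation (zdGraph d) (criticalProbI d)).real
        {ω | ∃ u ∈ Q, ∃ v ∈ Q,
          (∃ a ∈ innerBoundary (zdGraph d) (box d (2 * n)),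
            ω ∈ openConnIn (↑(box d (2 * n)) : Set (Site d)) u a) ∧
          (∃ b ∈ innerBoundary (zdGraph d) (box d (2 * n)),
            ω ∈ openConnIn (↑(box d (2 * n)) : Set (Site d)) v b) ∧
          ω ∉ openConnIn (↑(box d (2 * n)) : Set (Site d)) u v} ≤ (n : ℝ) ^ (-α)

/-- `stub_layerCake` (provable now, pure measure theory): for a probability measure, an antitone measurable
family `A k` ("`N ≥ k+1`"), finitely many measurable `B Q` with weights `c Q ≥ 0` and `c₀ ≥ 0`, the a.e.
pointwise bound `ω ∈ A k (k < K) ⇒ k + 1 ≤ c₀ + Σ_Q c_Q 1[B Q](ω)` integrates to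
`Σ_{k<K} P(A k) ≤ c₀ + Σ_Q c_Q P(B Q)` (`Σ_{k<K} 1[A k] ≤ majorant` pointwise by antitonicity, then integrate). -/
def stub_layerCake : Prop :=
  ∀ (d : ℕ) (μ : Measure (BondConfig (Site d))) [IsProbabilityMeasure μ] (K : ℕ)
    (A : ℕ → Set (BondConfig (Site d))) (𝒬 : Finset (Finset (Site d)))
    (B : Finset (Site d) → Set (BondConfig (Site d))) (c₀ : ℝ) (c : Finset (Site d) → ℝ),
    (∀ k, MeasurableSet (A k)) → (∀ Q, MeasurableSet (B Q)) →
    (∀ k k', k ≤ k' → A k' ⊆ A k) → 0 ≤ c₀ → (∀ Q, 0 ≤ c Q) →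
    (∀ᵐ ω ∂μ, ∀ k < K, ω ∈ A k → (k + 1 : ℝ) ≤ c₀ + ∑ Q ∈ 𝒬, (B Q).indicator (fun _ => c Q) ω) →
    ∑ k ∈ Finset.range K, μ.real (A k) ≤ c₀ + ∑ Q ∈ 𝒬, c Q * μ.real (B Q)

/-! ### Bulk sibling (triage r2-2 merge `avoidance-cost-covering ≈ boundary-pinning`): three box-distinct
crossers at LARGE ratio through one translate of `B(m)` on the MID-sphere (gen 3) -/

/-- `stub_midSphereCrossers` (provable now, deterministic, every `d`, `k ≥ 1`; multiplicity `r`): let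
`R := n + k m + 1` (so that `z + B(km) ⊆ B(2n-1) ∖ B(n)` for `‖z‖∞ = R`, given `2km + 2 ≤ n`) and let `𝒬` be
cells of coordinate-diameter `≤ m` contained in and covering the mid-sphere `∂ⁱⁿB(R)`, with chosen points
`z Q ∈ Q`. If there are `r·#𝒬 + 1` box-distinct crossers of `B(2n) ∖ B(n)`, then some cell `Q` is met (at first
exit through `∂ⁱⁿB(R)`) by `r + 1` of them, and these give `r + 1` points of `z_Q + B(m)`, each joined INSIDE
`z_Q + B(km)` to `∂ⁱⁿ(z_Q + B(km))` (first exit again), pairwise NOT joined inside `z_Q + B(km) ⊆ B(2n)`. -/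
def stub_midSphereCrossers : Prop :=
  ∀ (d n k m r : ℕ) (𝒬 : Finset (Finset (Site d))) (z : Finset (Site d) → Site d) (ω : BondConfig (Site d)),
    1 ≤ m → 1 ≤ k → 2 * k * m + 2 ≤ n → ω ⊆ (zdGraph d).edgeSet →
    (∀ Q ∈ 𝒬, Q ⊆ innerBoundary (zdGraph d) (box d (n + k * m + 1))) →
    (∀ Q ∈ 𝒬, z Q ∈ Q) →
    (∀ Q ∈ 𝒬, ∀ u ∈ Q, ∀ v ∈ Q, ∀ i : Fin d, |u i - v i| ≤ (m : ℤ)) →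
    (∀ y ∈ innerBoundary (zdGraph d) (box d (n + k * m + 1)), ∃ Q ∈ 𝒬, y ∈ Q) →
    ω ∈ repEvent d (r * 𝒬.card) n →
    ∃ Q ∈ 𝒬, ∃ x : Fin (r + 1) → Site d, (∀ i, x i ∈ GM.ball (z Q) m) ∧
      (∀ i, ∃ y ∈ innerBoundary (zdGraph d) (GM.ball (z Q) (k * m)),
        ω ∈ openConnIn (↑(GM.ball (z Q) (k * m)) : Set (Site d)) (x i) y) ∧
      ∀ i j, i ≠ j → ω ∉ openConnIn (↑(GM.ball (z Q) (k * m)) : Set (Site d)) (x i) (x j)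

/-- `stub_multiCrossAt_shift` (provable now, translation invariance, every `d`, `p`, `M`, radii `m, L`):
the translated multi-crosser event at `z` (`M+1` points of `z + B(m)`, each joined inside `z + B(L)` to
`∂ⁱⁿ(z + B(L))`, pairwise not joined inside `z + B(L)`) has the same probability as the one at the origin
(`bondPercolation_real_preimage_shift`, `GM.relabel_mem_openConnIn_iff`, `shift_preimage_ball`,
`mem_innerBoundary_ball_iff`, as in `KozmaNitzan.real_uniqZoneAt_eq`). -/
def stub_multiCrossAt_shift : Prop :=
  ∀ (d M m L : ℕ) (p : unitInterval) (z : Site d),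
    (bondPercolation (zdGraph d) p).real
      {ω | ∃ x : Fin (M + 1) → Site d, (∀ i, x i ∈ GM.ball z m) ∧
        (∀ i, ∃ y ∈ innerBoundary (zdGraph d) (GM.ball z L),
          ω ∈ openConnIn (↑(GM.ball z L) : Set (Site d)) (x i) y) ∧
        ∀ i j, i ≠ j → ω ∉ openConnIn (↑(GM.ball z L) : Set (Site d)) (x i) (x j)} =
    (bondPercolation (zdGraph d) p).real
      {ω | ∃ x : Fin (M + 1) → Site d, (∀ i, x i ∈ box d m) ∧
        (∀ i, ∃ y ∈ innerBoundary (zdGraph d) (box d L),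
          ω ∈ openConnIn (↑(box d L) : Set (Site d)) (x i) y) ∧
        ∀ i j, i ≠ j → ω ∉ openConnIn (↑(box d L) : Set (Site d)) (x i) (x j)}

/-- `stub_threeCrosserDecay` (OPEN — the BULK `d = 3` input, triage r2-2's sharpened `ThreeCrosserDecay` of card
`avoidance-cost-covering` in its weakest sufficient form): for every `η > 0` there is a ratio `k ≥ 2` such that,
for all large `m`, THREE points of `B(m)`, each joined inside `B(km)` to `∂ⁱⁿB(km)`, pairwise not joined inside
`B(km)` — three box-distinct crossers of the annulus `B(km) ∖ B(m)` — occur with `P_{p_c(ℤ³)}`-probability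
`≤ η / k²` (three-crosser decay `o(k⁻²) = o(1/#translates)`; predicted exponent `ζ₃ ≈ 3 > 2 = d - 1`, measured
`ζ₃,eff = 2.94–3.04` at `k = 6–8`, kit j014707; TWO crossers do NOT suffice: `ζ₂ = d - 1/ν ≈ 1.86 < 2`).
False for `d ≥ 7` under (t-c), like every sufficient condition (`Negative.nonProliferation_false_without_dimThree`). -/
def stub_threeCrosserDecay : Prop :=
  ∀ η : ℝ, 0 < η → ∃ k : ℕ, 2 ≤ k ∧ ∃ m₀ : ℕ, ∀ m : ℕ, m₀ ≤ m →
    (k : ℝ) ^ 2 * (bondPercolation (zdGraph 3) (criticalProbI 3)).real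
      {ω | ∃ x : Fin (2 + 1) → Site 3, (∀ i, x i ∈ box 3 m) ∧
        (∀ i, ∃ y ∈ innerBoundary (zdGraph 3) (box 3 (k * m)),
          ω ∈ openConnIn (↑(box 3 (k * m)) : Set (Site 3)) (x i) y) ∧
        ∀ i j, i ≠ j → ω ∉ openConnIn (↑(box 3 (k * m)) : Set (Site 3)) (x i) (x j)} ≤ η

end Stubs

/-! ## The stubs, spelled out (registered by name + signature; five are aliases of landed theorems) -/

/-- Registered stub `stub_cellUnionBound` — LANDED (p101623,
`Theorems/PercNonProliferationNonProliferationStubCellUnionBound.lean`). -/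
theorem stub_cellUnionBound :
    ∀ (d n : ℕ) (p : unitInterval) (𝒬 : Finset (Finset (Site d))),
    (∀ y ∈ innerBoundary (zdGraph d) (box d (2 * n)), ∃ Q ∈ 𝒬, y ∈ Q) →
    (bondPercolation (zdGraph d) p).real (repEvent d 𝒬.card n) ≤
      ∑ Q ∈ 𝒬, (bondPercolation (zdGraph d) p).real
        {ω | ∃ u ∈ Q, ∃ v ∈ Q, (∃ a ∈ box d n, ω ∈ openConnIn (↑(box d (2 * n)) : Set (Site d)) u a) ∧
          (∃ b ∈ box d n, ω ∈ openConnIn (↑(box d (2 * n)) : Set (Site d)) v b) ∧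
          ω ∉ openConnIn (↑(box d (2 * n)) : Set (Site d)) u v} :=
  _root_.Summit.CriticalPhenomena.PercolationContinuityZ3.Theorems.NonProliferation.stub_cellUnionBound

/-- Registered stub `stub_boundaryGrid` — LANDED (p102171,
`Theorems/PercNonProliferationNonProliferationStubBoundaryGrid.lean`). -/
theorem stub_boundaryGrid :
    ∀ (d R s : ℕ), 1 ≤ s →
    ∃ 𝒬 : Finset (Finset (Site d)),
      (∀ Q ∈ 𝒬, Q ⊆ innerBoundary (zdGraph d) (box d R)) ∧
      (∀ Q ∈ 𝒬, ∀ u ∈ Q, ∀ v ∈ Q, ∀ i : Fin d, |u i - v i| + 1 ≤ (s : ℤ)) ∧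
      (∀ Q ∈ 𝒬, Q.card ≤ s ^ d) ∧
      (∀ y ∈ innerBoundary (zdGraph d) (box d R), ∃ Q ∈ 𝒬, y ∈ Q) ∧
      ((𝒬.card : ℝ) ≤ 2 * d * (2 * (R : ℝ) / s + 2) ^ (d - 1)) :=
  _root_.Summit.CriticalPhenomena.PercolationContinuityZ3.Theorems.NonProliferation.stub_boundaryGrid

/-- Registered stub `stub_boundaryCellTwoArm` — OPEN (the lead's; the `d = 3` input of the line). -/
theorem stub_boundaryCellTwoArm :
    ∀ δ : ℝ, 0 < δ → ∃ ε : ℝ, 0 < ε ∧ ε ≤ 1 ∧ ∃ᶠ n : ℕ in atTop,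
    ∀ Q : Finset (Site 3), Q ⊆ innerBoundary (zdGraph 3) (box 3 (2 * n)) →
      (∀ u ∈ Q, ∀ v ∈ Q, ∀ i : Fin 3, ((|u i - v i| : ℤ) : ℝ) ≤ ε * n) →
      (bondPercolation (zdGraph 3) (criticalProbI 3)).real
        {ω | ∃ u ∈ Q, ∃ v ∈ Q, (∃ a ∈ box 3 n, ω ∈ openConnIn (↑(box 3 (2 * n)) : Set (Site 3)) u a) ∧
          (∃ b ∈ box 3 n, ω ∈ openConnIn (↑(box 3 (2 * n)) : Set (Site 3)) v b) ∧
          ω ∉ openConnIn (↑(box 3 (2 * n)) : Set (Site 3)) u v} ≤ δ * ε ^ 2 := by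
  sorry

/-- Registered stub `stub_innerCellCount` — LANDED (p101291,
`Theorems/PercNonProliferationNonProliferationStubInnerCellCount.lean`). -/
theorem stub_innerCellCount :
    ∀ (d n k : ℕ) (𝒬 : Finset (Finset (Site d))) (ω : BondConfig (Site d)),
    1 ≤ n → ω ⊆ (zdGraph d).edgeSet →
    (∀ y ∈ innerBoundary (zdGraph d) (box d n), ∃ Q ∈ 𝒬, y ∈ Q) →
    ω ∈ repEvent d k n →
    (k + 1 : ℝ) ≤ 𝒬.card + ∑ Q ∈ 𝒬,
      Set.indicator {ω' : BondConfig (Site d) | ∃ u ∈ Q, ∃ v ∈ Q,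
          (∃ a ∈ innerBoundary (zdGraph d) (box d (2 * n)),
            ω' ∈ openConnIn (↑(box d (2 * n)) : Set (Site d)) u a) ∧
          (∃ b ∈ innerBoundary (zdGraph d) (box d (2 * n)),
            ω' ∈ openConnIn (↑(box d (2 * n)) : Set (Site d)) v b) ∧
          ω' ∉ openConnIn (↑(box d (2 * n)) : Set (Site d)) u v}
        (fun _ => (Q.card : ℝ)) ω :=
  _root_.Summit.CriticalPhenomena.PercolationContinuityZ3.Theorems.NonProliferation.stub_innerCellCount

/-- Registered stub `stub_innerTwoArmDecay` — LANDED (p103479,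
`Theorems/PercNonProliferationNonProliferationStubInnerTwoArmDecay.lean`). -/
theorem stub_innerTwoArmDecay :
    ∀ d : ℕ, 2 ≤ d → ∃ α : ℝ, 0 < α ∧ ∃ n₁ : ℕ, ∀ n : ℕ, n₁ ≤ n →
    ∀ Q : Finset (Site d), Q ⊆ box d n →
      (∀ u ∈ Q, ∀ v ∈ Q, ∀ i : Fin d, |u i - v i| ≤ ((⌊(n : ℝ) ^ α⌋₊ : ℕ) : ℤ)) →
      (bondPercolation (zdGraph d) (criticalProbI d)).real
        {ω | ∃ u ∈ Q, ∃ v ∈ Q,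
          (∃ a ∈ innerBoundary (zdGraph d) (box d (2 * n)),
            ω ∈ openConnIn (↑(box d (2 * n)) : Set (Site d)) u a) ∧
          (∃ b ∈ innerBoundary (zdGraph d) (box d (2 * n)),
            ω ∈ openConnIn (↑(box d (2 * n)) : Set (Site d)) v b) ∧
          ω ∉ openConnIn (↑(box d (2 * n)) : Set (Site d)) u v} ≤ (n : ℝ) ^ (-α) :=
  _root_.Summit.CriticalPhenomena.PercolationContinuityZ3.Theorems.NonProliferation.stub_innerTwoArmDecay

/-- Registered stub `stub_layerCake` — LANDED (p101427,
`Theorems/PercNonProliferationNonProliferationStubLayerCake.lean`). -/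
theorem stub_layerCake :
    ∀ (d : ℕ) (μ : Measure (BondConfig (Site d))) [IsProbabilityMeasure μ] (K : ℕ)
    (A : ℕ → Set (BondConfig (Site d))) (𝒬 : Finset (Finset (Site d)))
    (B : Finset (Site d) → Set (BondConfig (Site d))) (c₀ : ℝ) (c : Finset (Site d) → ℝ),
    (∀ k, MeasurableSet (A k)) → (∀ Q, MeasurableSet (B Q)) →
    (∀ k k', k ≤ k' → A k' ⊆ A k) → 0 ≤ c₀ → (∀ Q, 0 ≤ c Q) →
    (∀ᵐ ω ∂μ, ∀ k < K, ω ∈ A k → (k + 1 : ℝ) ≤ c₀ + ∑ Q ∈ 𝒬, (B Q).indicator (fun _ => c Q) ω) →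
    ∑ k ∈ Finset.range K, μ.real (A k) ≤ c₀ + ∑ Q ∈ 𝒬, c Q * μ.real (B Q) :=
  _root_.Summit.CriticalPhenomena.PercolationContinuityZ3.Theorems.NonProliferation.stub_layerCake

/-- Registered stub `stub_midSphereCrossers` (gen 4: RESHAPED — wave-2 worker's `stub-misstated`: the gen-3 text allowed
`k = 0`, where `z + B(0) = {z}` makes the conclusion false for `r ≥ 1`; fixed by the hypothesis `1 ≤ k`, which the
composition has as `2 ≤ k`) — LANDED (`Theorems/PercNonProliferationNonProliferationStubMidSphereCrossers.lean`). -/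
theorem stub_midSphereCrossers :
    ∀ (d n k m r : ℕ) (𝒬 : Finset (Finset (Site d))) (z : Finset (Site d) → Site d) (ω : BondConfig (Site d)),
    1 ≤ m → 1 ≤ k → 2 * k * m + 2 ≤ n → ω ⊆ (zdGraph d).edgeSet →
    (∀ Q ∈ 𝒬, Q ⊆ innerBoundary (zdGraph d) (box d (n + k * m + 1))) →
    (∀ Q ∈ 𝒬, z Q ∈ Q) →
    (∀ Q ∈ 𝒬, ∀ u ∈ Q, ∀ v ∈ Q, ∀ i : Fin d, |u i - v i| ≤ (m : ℤ)) →
    (∀ y ∈ innerBoundary (zdGraph d) (box d (n + k * m + 1)), ∃ Q ∈ 𝒬, y ∈ Q) →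
    ω ∈ repEvent d (r * 𝒬.card) n →
    ∃ Q ∈ 𝒬, ∃ x : Fin (r + 1) → Site d, (∀ i, x i ∈ GM.ball (z Q) m) ∧
      (∀ i, ∃ y ∈ innerBoundary (zdGraph d) (GM.ball (z Q) (k * m)),
        ω ∈ openConnIn (↑(GM.ball (z Q) (k * m)) : Set (Site d)) (x i) y) ∧
      ∀ i j, i ≠ j → ω ∉ openConnIn (↑(GM.ball (z Q) (k * m)) : Set (Site d)) (x i) (x j) :=
  _root_.Summit.CriticalPhenomena.PercolationContinuityZ3.Theorems.NonProliferation.stub_midSphereCrossers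

/-- Registered stub `stub_multiCrossAt_shift` (gen 3) — LANDED (p107378,
`Theorems/PercNonProliferationNonProliferationStubMultiCrossAtShift.lean`). -/
theorem stub_multiCrossAt_shift :
    ∀ (d M m L : ℕ) (p : unitInterval) (z : Site d),
    (bondPercolation (zdGraph d) p).real
      {ω | ∃ x : Fin (M + 1) → Site d, (∀ i, x i ∈ GM.ball z m) ∧
        (∀ i, ∃ y ∈ innerBoundary (zdGraph d) (GM.ball z L),
          ω ∈ openConnIn (↑(GM.ball z L) : Set (Site d)) (x i) y) ∧
        ∀ i j, i ≠ j → ω ∉ openConnIn (↑(GM.ball z L) : Set (Site d)) (x i) (x j)} =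
    (bondPercolation (zdGraph d) p).real
      {ω | ∃ x : Fin (M + 1) → Site d, (∀ i, x i ∈ box d m) ∧
        (∀ i, ∃ y ∈ innerBoundary (zdGraph d) (box d L),
          ω ∈ openConnIn (↑(box d L) : Set (Site d)) (x i) y) ∧
        ∀ i j, i ≠ j → ω ∉ openConnIn (↑(box d L) : Set (Site d)) (x i) (x j)} :=
  _root_.Summit.CriticalPhenomena.PercolationContinuityZ3.Theorems.NonProliferation.stub_multiCrossAt_shift

/-- Registered stub `stub_threeCrosserDecay` (gen 3) — OPEN (the bulk `d = 3` input, sibling of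
`stub_boundaryCellTwoArm`; either one closes the crux). -/
theorem stub_threeCrosserDecay :
    ∀ η : ℝ, 0 < η → ∃ k : ℕ, 2 ≤ k ∧ ∃ m₀ : ℕ, ∀ m : ℕ, m₀ ≤ m →
    (k : ℝ) ^ 2 * (bondPercolation (zdGraph 3) (criticalProbI 3)).real
      {ω | ∃ x : Fin (2 + 1) → Site 3, (∀ i, x i ∈ box 3 m) ∧
        (∀ i, ∃ y ∈ innerBoundary (zdGraph 3) (box 3 (k * m)),
          ω ∈ openConnIn (↑(box 3 (k * m)) : Set (Site 3)) (x i) y) ∧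
        ∀ i j, i ≠ j → ω ∉ openConnIn (↑(box 3 (k * m)) : Set (Site 3)) (x i) (x j)} ≤ η := by
  sorry

/-! ## Bridges between the spelled-out stub statements and the line's vocabulary (`Iff.rfl`) -/

/-- The set in `stub_cellUnionBound` / `stub_boundaryCellTwoArm` is `faceTwoArm`. -/
theorem faceTwoArm_def (d n : ℕ) (Q : Finset (Site d)) :
    faceTwoArm d n Q = {ω | ∃ u ∈ Q, ∃ v ∈ Q,
      (∃ a ∈ box d n, ω ∈ openConnIn (↑(box d (2 * n)) : Set (Site d)) u a) ∧
      (∃ b ∈ box d n, ω ∈ openConnIn (↑(box d (2 * n)) : Set (Site d)) v b) ∧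
      ω ∉ openConnIn (↑(box d (2 * n)) : Set (Site d)) u v} := rfl

/-- The set in `stub_innerCellCount` / `stub_innerTwoArmDecay` is `innerTwoArm`. -/
theorem innerTwoArm_def (d n : ℕ) (Q : Finset (Site d)) :
    innerTwoArm d n Q = {ω | ∃ u ∈ Q, ∃ v ∈ Q,
      (∃ a ∈ innerBoundary (zdGraph d) (box d (2 * n)), ω ∈ openConnIn (↑(box d (2 * n)) : Set (Site d)) u a) ∧
      (∃ b ∈ innerBoundary (zdGraph d) (box d (2 * n)), ω ∈ openConnIn (↑(box d (2 * n)) : Set (Site d)) v b) ∧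
      ω ∉ openConnIn (↑(box d (2 * n)) : Set (Site d)) u v} := rfl

/-! ## The composition (kernel-checked): the three boundary stubs give the crux BY NAME -/

/-- Arithmetic of the mesh: if `ε ≤ 1`, `2 ≤ ε n` and `s = ⌊ε n⌋`, then `6 (4n/s + 2)² ≤ 600/ε²`. -/
theorem grid_count_le {ε : ℝ} {n s : ℕ} (hε0 : 0 < ε) (hε1 : ε ≤ 1) (hn : 2 ≤ ε * n)
    (hs : s = ⌊ε * n⌋₊) :
    2 * (3 : ℝ) * (2 * ((2 * n : ℕ) : ℝ) / s + 2) ^ (3 - 1) ≤ 600 / ε ^ 2 := by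
  have hs_gt : ε * n - 1 < s := by rw [hs]; exact Nat.sub_one_lt_floor (ε * n)
  have hs_ge : ε * n / 2 ≤ s := by linarith
  have hs_pos : (0 : ℝ) < s := by linarith
  have h1 : 2 * ((2 * n : ℕ) : ℝ) / s ≤ 8 / ε := by
    rw [div_le_div_iff₀ hs_pos hε0]
    push_cast
    nlinarith
  have h2 : 2 * ((2 * n : ℕ) : ℝ) / s + 2 ≤ 10 / ε := by
    have h3 : (2 : ℝ) ≤ 2 / ε := by
      rw [le_div_iff₀ hε0]; nlinarith
    have h4 : 8 / ε + 2 / ε = 10 / ε := by ring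
    linarith
  have h0 : (0 : ℝ) ≤ 2 * ((2 * n : ℕ) : ℝ) / s + 2 := by positivity
  calc 2 * (3 : ℝ) * (2 * ((2 * n : ℕ) : ℝ) / s + 2) ^ (3 - 1)
      = 6 * (2 * ((2 * n : ℕ) : ℝ) / s + 2) ^ 2 := by norm_num
    _ ≤ 6 * (10 / ε) ^ 2 := by gcongr
    _ = 600 / ε ^ 2 := by ring

/-- **The line's composition.** `stub_cellUnionBound → stub_boundaryGrid → stub_boundaryCellTwoArm → crux`:
with `δ = 1/1200`, mesh `ε`, cell side `s = ⌊εn⌋` (`≥ εn/2` once `εn ≥ 2`), the grid has `≤ 600/ε²` cells,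
each of coordinate-diameter `< s ≤ εn`, so `P(N_n ≥ #cells + 1) ≤ (600/ε²)·(ε²/1200) = 1/2`; with
`M := ⌊600/ε²⌋ ≥ #cells` and antitonicity of `repEvent` in `M`, `P(N_n ≤ M) ≥ 1/2` for infinitely many `n`. -/
theorem NonProliferation_of (h1 : Stubs.stub_cellUnionBound) (h2 : Stubs.stub_boundaryGrid)
    (h3 : Stubs.stub_boundaryCellTwoArm) : NonProliferation := by
  rw [nonProliferation_iff]
  obtain ⟨ε, hε0, hε1, hfreq⟩ := h3 (1 / 1200) (by norm_num)
  refine ⟨⌊600 / ε ^ 2⌋₊, 1 / 2, by norm_num, ?_⟩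
  have hev : ∀ᶠ n : ℕ in atTop, 2 ≤ ε * n := by
    refine (eventually_ge_atTop ⌈2 / ε⌉₊).mono fun n hn => ?_
    have h' : 2 / ε ≤ n := (Nat.le_ceil _).trans (by exact_mod_cast hn)
    rwa [div_le_iff₀ hε0, mul_comm] at h'
  refine (hfreq.and_eventually hev).mono fun n hn => ?_
  obtain ⟨hQ, hn2⟩ := hn
  -- the grid at radius `2n`, cell side `s = ⌊ε n⌋ ≥ 1`
  set s : ℕ := ⌊ε * n⌋₊ with hs
  have hs1 : 1 ≤ s := by
    rw [hs, Nat.one_le_floor_iff]; linarith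
  obtain ⟨𝒬, hsub, hdiam, -, hcov, hcount⟩ := h2 3 (2 * n) s hs1
  have hs_le : (s : ℝ) ≤ ε * n := Nat.floor_le (by positivity)
  -- per-cell bound from the open stub
  have hcell : ∀ Q ∈ 𝒬, (Pc 3).real (faceTwoArm 3 n Q) ≤ 1 / 1200 * ε ^ 2 := by
    intro Q hQ𝒬
    refine hQ Q (hsub Q hQ𝒬) fun u hu v hv i => ?_
    have h := hdiam Q hQ𝒬 u hu v hv i
    have h' : ((|u i - v i| : ℤ) : ℝ) + 1 ≤ s := by exact_mod_cast h
    linarith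
  -- union bound + count
  have hunion : (Pc 3).real (repEvent 3 𝒬.card n) ≤ 1 / 2 := by
    calc (Pc 3).real (repEvent 3 𝒬.card n)
        ≤ ∑ Q ∈ 𝒬, (Pc 3).real (faceTwoArm 3 n Q) := h1 3 n (criticalProbI 3) 𝒬 hcov
      _ ≤ ∑ Q ∈ 𝒬, 1 / 1200 * ε ^ 2 := Finset.sum_le_sum hcell
      _ = 𝒬.card * (1 / 1200 * ε ^ 2) := by rw [Finset.sum_const, nsmul_eq_mul]
      _ ≤ 600 / ε ^ 2 * (1 / 1200 * ε ^ 2) := by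
          gcongr
          exact hcount.trans (grid_count_le hε0 hε1 hn2 hs)
      _ = 1 / 2 := by field_simp; ring
  -- pass to the fixed `M = ⌊600/ε²⌋ ≥ #cells`
  have hM : 𝒬.card ≤ ⌊600 / ε ^ 2⌋₊ :=
    Nat.le_floor (hcount.trans (grid_count_le hε0 hε1 hn2 hs))
  have hmono : (Pc 3).real (repEvent 3 ⌊600 / ε ^ 2⌋₊ n) ≤ (Pc 3).real (repEvent 3 𝒬.card n) :=
    measureReal_mono (repEvent_antitone 3 n hM) (measure_ne_top _ _)
  rw [probReal_compl_eq_one_sub (measurableSet_repEvent 3 _ n)]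
  linarith

/-- **The crux, by name, modulo the single open stub `stub_boundaryCellTwoArm`.** -/
theorem NonProliferation_proof : NonProliferation :=
  NonProliferation_of stub_cellUnionBound stub_boundaryGrid stub_boundaryCellTwoArm

/-! ## The exponent form of the open stub implies the registered `o(ε²)` form -/

/-- Ideator 5's exponent form `BoundaryCellTwoArmExp` (cells `Q ⊆ ∂ⁱⁿB(2n)` of coordinate-diameter `≤ r`,
`1 ≤ r ≤ n`: `P(faceTwoArm n Q) ≤ C (r/n)^a` with `a > 2`), restated over the line's vocabulary. -/
def BoundaryCellTwoArmExp : Prop :=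
  ∃ a C : ℝ, 2 < a ∧ ∀ n : ℕ, 1 ≤ n → ∀ r : ℕ, 1 ≤ r → r ≤ n → ∀ Q : Finset (Site 3),
    Q ⊆ innerBoundary (zdGraph 3) (box 3 (2 * n)) →
    (∀ u ∈ Q, ∀ v ∈ Q, ∀ i : Fin 3, |u i - v i| ≤ (r : ℤ)) →
      (bondPercolation (zdGraph 3) (criticalProbI 3)).real (faceTwoArm 3 n Q) ≤ C * ((r : ℝ) / n) ^ a

/-- The exponent form implies the registered `o(ε²)` form (even EVENTUALLY in `n`): with
`r := ⌈εn⌉ ≤ 2εn` (once `εn ≥ 1`), `P ≤ C (r/n)^a ≤ C⁺ 2^a ε^{a-2} · ε² ≤ δ ε²` for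
`ε := min 1 ((δ/K)^{1/(a-2)})`, `K := C⁺ 2^a + 1`, `C⁺ := max C 0`. -/
theorem stub_boundaryCellTwoArm_of_exp (h : BoundaryCellTwoArmExp) : Stubs.stub_boundaryCellTwoArm := by
  obtain ⟨a, C, ha, hexp⟩ := h
  intro δ hδ
  set C' : ℝ := max C 0 with hC'
  have hC'0 : 0 ≤ C' := le_max_right _ _
  have hCC' : C ≤ C' := le_max_left _ _
  set K : ℝ := C' * (2 : ℝ) ^ a + 1 with hK
  have h2a : (0 : ℝ) < (2 : ℝ) ^ a := Real.rpow_pos_of_pos two_pos a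
  have hK0 : 0 < K := by have := mul_nonneg hC'0 h2a.le; linarith
  have ha2 : 0 < a - 2 := by linarith
  set ε : ℝ := min 1 ((δ / K) ^ (a - 2)⁻¹) with hε
  have hq0 : 0 < (δ / K) ^ (a - 2)⁻¹ := Real.rpow_pos_of_pos (div_pos hδ hK0) _
  have hε0 : 0 < ε := lt_min one_pos hq0
  have hε1 : ε ≤ 1 := min_le_left _ _
  have hεa : ε ^ (a - 2) ≤ δ / K := by
    calc ε ^ (a - 2) ≤ ((δ / K) ^ (a - 2)⁻¹) ^ (a - 2) :=
          Real.rpow_le_rpow hε0.le (min_le_right _ _) ha2.le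
      _ = δ / K := Real.rpow_inv_rpow (div_pos hδ hK0).le ha2.ne'
  refine ⟨ε, hε0, hε1, Eventually.frequently ?_⟩
  have hev : ∀ᶠ n : ℕ in atTop, 1 ≤ ε * n := by
    refine (eventually_ge_atTop ⌈1 / ε⌉₊).mono fun n hn => ?_
    have h' : 1 / ε ≤ n := (Nat.le_ceil _).trans (by exact_mod_cast hn)
    rwa [div_le_iff₀ hε0, mul_comm] at h'
  filter_upwards [hev, eventually_ge_atTop 1] with n hn hn1
  intro Q hQ hdiam
  have hn0 : (0 : ℝ) < n := by exact_mod_cast hn1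
  -- integer radius `r = ⌈ε n⌉`, `1 ≤ r ≤ n`, `r ≤ 2 ε n`
  set r : ℕ := ⌈ε * n⌉₊ with hr
  have hr1 : 1 ≤ r := by
    rw [hr, Nat.one_le_ceil_iff]; linarith
  have hrn : r ≤ n := by
    rw [hr, Nat.ceil_le]
    calc ε * n ≤ 1 * n := by gcongr
      _ = n := one_mul _
  have hr2 : (r : ℝ) ≤ 2 * (ε * n) := by
    have : (r : ℝ) < ε * n + 1 := by rw [hr]; exact Nat.ceil_lt_add_one (by positivity)
    linarith
  have hdiam' : ∀ u ∈ Q, ∀ v ∈ Q, ∀ i : Fin 3, |u i - v i| ≤ (r : ℤ) := by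
    intro u hu v hv i
    have h1 := hdiam u hu v hv i
    have h2 : ε * n ≤ r := by rw [hr]; exact Nat.le_ceil _
    exact_mod_cast h1.trans h2
  have hmain := hexp n hn1 r hr1 hrn Q hQ hdiam'
  rw [faceTwoArm_def] at hmain
  refine hmain.trans ?_
  have hrn0 : (0 : ℝ) ≤ (r : ℝ) / n := by positivity
  have hrn2 : (r : ℝ) / n ≤ 2 * ε := by
    rw [div_le_iff₀ hn0]; linarith
  calc C * ((r : ℝ) / n) ^ a ≤ C' * ((r : ℝ) / n) ^ a := by
        gcongr
    _ ≤ C' * (2 * ε) ^ a := by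
        gcongr
    _ = C' * (2 : ℝ) ^ a * (ε ^ (a - 2) * ε ^ 2) := by
        rw [Real.mul_rpow two_pos.le hε0.le, ← Real.rpow_two, ← Real.rpow_add hε0]
        ring_nf
    _ ≤ C' * (2 : ℝ) ^ a * (δ / K * ε ^ 2) := by
        gcongr
    _ = (C' * (2 : ℝ) ^ a / K) * δ * ε ^ 2 := by
        field_simp
    _ ≤ 1 * δ * ε ^ 2 := by
        gcongr
        rw [div_le_one hK0, hK]; linarith
    _ = δ * ε ^ 2 := by ring

/-! ## The bulk composition (gen 3): mid-sphere cells + translation + three-crosser decay ⇒ crux -/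

/-- The translated multi-crosser event at `z`: `M+1` points of `z + B(m)`, each joined inside `z + B(L)` to
`∂ⁱⁿ(z + B(L))`, pairwise not joined inside `z + B(L)`. -/
def multiCrossAt (d M : ℕ) (z : Site d) (m L : ℕ) : Set (BondConfig (Site d)) :=
  {ω | ∃ x : Fin (M + 1) → Site d, (∀ i, x i ∈ GM.ball z m) ∧
    (∀ i, ∃ y ∈ innerBoundary (zdGraph d) (GM.ball z L),
      ω ∈ openConnIn (↑(GM.ball z L) : Set (Site d)) (x i) y) ∧
    ∀ i j, i ≠ j → ω ∉ openConnIn (↑(GM.ball z L) : Set (Site d)) (x i) (x j)}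

/-- The multi-crosser event at the origin (`multiCross d M m (2m)… `; at `L = 2m` it is `repEvent d M m`). -/
def multiCross (d M m L : ℕ) : Set (BondConfig (Site d)) :=
  {ω | ∃ x : Fin (M + 1) → Site d, (∀ i, x i ∈ box d m) ∧
    (∀ i, ∃ y ∈ innerBoundary (zdGraph d) (box d L),
      ω ∈ openConnIn (↑(box d L) : Set (Site d)) (x i) y) ∧
    ∀ i j, i ≠ j → ω ∉ openConnIn (↑(box d L) : Set (Site d)) (x i) (x j)}

/-- At ratio `2` the multi-crosser event IS `repEvent`. -/
theorem multiCross_two_mul (d M m : ℕ) : multiCross d M m (2 * m) = repEvent d M m := rfl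

/-- Arithmetic of the bulk covering: with `k ≥ 2`, `m ≥ 1`, `2km + 2 ≤ n ≤ 2k(m+1) + 2`, the grid of
`stub_boundaryGrid` on the mid-sphere `∂ⁱⁿB(n + km + 1)` with cell side `m + 1` has `≤ 726 k²` cells. -/
theorem bulk_count_le {n k m : ℕ} (hk : 2 ≤ k) (hm1 : 1 ≤ m) (h2km : 2 * k * m + 2 ≤ n)
    (hn : n ≤ 2 * k * (m + 1) + 2) :
    2 * (3 : ℝ) * (2 * ((n + k * m + 1 : ℕ) : ℝ) / ((m + 1 : ℕ) : ℝ) + 2) ^ (3 - 1) ≤ 726 * (k : ℝ) ^ 2 := by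
  have hM : (0 : ℝ) < ((m + 1 : ℕ) : ℝ) := by positivity
  have hk' : (2 : ℝ) ≤ k := by exact_mod_cast hk
  have hm' : (1 : ℝ) ≤ m := by exact_mod_cast hm1
  have h1 : (2 * k * m + 2 : ℝ) ≤ n := by exact_mod_cast h2km
  have h2 : (n : ℝ) ≤ 2 * k * (m + 1) + 2 := by exact_mod_cast hn
  have hbase : 2 * ((n + k * m + 1 : ℕ) : ℝ) / ((m + 1 : ℕ) : ℝ) ≤ 6 * k + 3 := by
    rw [div_le_iff₀ hM]; push_cast; nlinarith
  have h0 : (0 : ℝ) ≤ 2 * ((n + k * m + 1 : ℕ) : ℝ) / ((m + 1 : ℕ) : ℝ) + 2 := by positivity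
  have hb2 : 2 * ((n + k * m + 1 : ℕ) : ℝ) / ((m + 1 : ℕ) : ℝ) + 2 ≤ 11 * k := by linarith
  calc 2 * (3 : ℝ) * (2 * ((n + k * m + 1 : ℕ) : ℝ) / ((m + 1 : ℕ) : ℝ) + 2) ^ (3 - 1)
      = 6 * (2 * ((n + k * m + 1 : ℕ) : ℝ) / ((m + 1 : ℕ) : ℝ) + 2) ^ 2 := by norm_num
    _ ≤ 6 * (11 * (k : ℝ)) ^ 2 := by gcongr
    _ = 726 * (k : ℝ) ^ 2 := by ring

/-- **The bulk composition.** `stub_midSphereCrossers → stub_multiCrossAt_shift → stub_threeCrosserDecay → crux`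
(with the landed grid `stub_boundaryGrid`): `η := 1/1452` gives a ratio `k` and `m₀`; for
`n ≥ 2k(m₀+1)+2` put `m := ⌊(n-2)/(2k)⌋ ≥ m₀`, `R := n + km + 1`; the non-empty grid cells of side `m+1` on
`∂ⁱⁿB(R)` number `≤ 726k²`; `2·#cells + 1` crossers put three through one cell, i.e. the translated
three-crosser event at its chosen point (a.e., lattice configurations), of probability `= P(three-crosser at 0)
≤ η/k²`; union: `P(N_n ≥ 2·726k² + 1) ≤ 726k² · η/k² = 1/2`. -/
theorem NonProliferation_of_bulk (hB1 : Stubs.stub_midSphereCrossers) (hB2 : Stubs.stub_multiCrossAt_shift)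
    (hB3 : Stubs.stub_threeCrosserDecay) : NonProliferation := by
  classical
  rw [nonProliferation_iff]
  obtain ⟨k, hk, m₀, hdec⟩ := hB3 (1 / 1452) (by norm_num)
  refine ⟨2 * (726 * k ^ 2), 1 / 2, by norm_num, Eventually.frequently ?_⟩
  filter_upwards [eventually_ge_atTop (2 * k * (m₀ + 1) + 2)] with n hn
  -- scales
  have hk0 : 0 < 2 * k := by omega
  set m : ℕ := (n - 2) / (2 * k) with hm
  have hm₀ : m₀ + 1 ≤ m := by
    rw [hm, Nat.le_div_iff_mul_le hk0]
    have : 2 * k * (m₀ + 1) = (m₀ + 1) * (2 * k) := by ring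
    omega
  have hm1 : 1 ≤ m := le_trans (by omega) hm₀
  have hmm₀ : m₀ ≤ m := by omega
  have h2km : 2 * k * m + 2 ≤ n := by
    have h := Nat.div_mul_le_self (n - 2) (2 * k)
    rw [← hm] at h
    have : 2 * k * m = m * (2 * k) := by ring
    omega
  have hn' : n ≤ 2 * k * (m + 1) + 2 := by
    have h := Nat.lt_div_mul_add hk0 (a := n - 2)
    rw [← hm] at h
    have : 2 * k * (m + 1) = m * (2 * k) + 2 * k := by ring
    omega
  -- grid on the mid-sphere `∂ⁱⁿB(n + km + 1)`, cell side `m + 1`, non-empty cells, chosen points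
  obtain ⟨𝒬, hsub, hdiam, -, hcov, hcount⟩ := stub_boundaryGrid 3 (n + k * m + 1) (m + 1) (by omega)
  set 𝒬' : Finset (Finset (Site 3)) := 𝒬.filter (fun Q => Q.Nonempty) with h𝒬'
  set z : Finset (Site 3) → Site 3 := fun Q => if h : Q.Nonempty then h.choose else 0 with hz
  have hz_mem : ∀ Q ∈ 𝒬', z Q ∈ Q := by
    intro Q hQ
    have hne : Q.Nonempty := (Finset.mem_filter.1 hQ).2
    simp only [hz, dif_pos hne]
    exact hne.choose_spec
  have hsub' : ∀ Q ∈ 𝒬', Q ⊆ innerBoundary (zdGraph 3) (box 3 (n + k * m + 1)) :=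
    fun Q hQ => hsub Q (Finset.mem_filter.1 hQ).1
  have hdiam' : ∀ Q ∈ 𝒬', ∀ u ∈ Q, ∀ v ∈ Q, ∀ i : Fin 3, |u i - v i| ≤ (m : ℤ) := by
    intro Q hQ u hu v hv i
    have h := hdiam Q (Finset.mem_filter.1 hQ).1 u hu v hv i
    push_cast at h
    linarith
  have hcov' : ∀ y ∈ innerBoundary (zdGraph 3) (box 3 (n + k * m + 1)), ∃ Q ∈ 𝒬', y ∈ Q := by
    intro y hy
    obtain ⟨Q, hQ, hyQ⟩ := hcov y hy
    exact ⟨Q, Finset.mem_filter.2 ⟨hQ, ⟨y, hyQ⟩⟩, hyQ⟩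
  have hcard' : (𝒬'.card : ℝ) ≤ 726 * (k : ℝ) ^ 2 := by
    have h1 : (𝒬'.card : ℝ) ≤ 𝒬.card := by exact_mod_cast Finset.card_filter_le _ _
    have h2 : (𝒬.card : ℝ) ≤ 2 * (3 : ℝ) * (2 * ((n + k * m + 1 : ℕ) : ℝ) / ((m + 1 : ℕ) : ℝ) + 2) ^ (3 - 1) := by
      exact_mod_cast hcount
    exact h1.trans (h2.trans (bulk_count_le hk hm1 h2km hn'))
  have hcardN : 𝒬'.card ≤ 726 * k ^ 2 := by exact_mod_cast hcard'
  -- three crossers through one cell (a.e.), union bound, translation, decay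
  have hincl : ∀ᵐ ω ∂(Pc 3), ω ∈ repEvent 3 (2 * 𝒬'.card) n →
      ω ∈ ⋃ Q ∈ 𝒬', multiCrossAt 3 2 (z Q) m (k * m) := by
    filter_upwards [ae_subset_edgeSet (zdGraph 3) (criticalProbI 3)] with ω hω hrep
    obtain ⟨Q, hQ, x, hx⟩ := hB1 3 n k m 2 𝒬' z ω hm1 (by omega) h2km hω hsub' hz_mem hdiam' hcov' hrep
    exact Set.mem_biUnion hQ ⟨x, hx⟩
  have hP0 : (k : ℝ) ^ 2 * (Pc 3).real (multiCross 3 2 m (k * m)) ≤ 1 / 1452 := hdec m hmm₀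
  have hkpos : (0 : ℝ) < (k : ℝ) ^ 2 := by positivity
  have hunion : (Pc 3).real (repEvent 3 (2 * 𝒬'.card) n) ≤ 1 / 2 := by
    calc (Pc 3).real (repEvent 3 (2 * 𝒬'.card) n)
        ≤ (Pc 3).real (⋃ Q ∈ 𝒬', multiCrossAt 3 2 (z Q) m (k * m)) := by
          simp only [measureReal_def]
          exact ENNReal.toReal_mono (measure_ne_top _ _) (measure_mono_ae hincl)
      _ ≤ ∑ Q ∈ 𝒬', (Pc 3).real (multiCrossAt 3 2 (z Q) m (k * m)) := measureReal_biUnion_finset_le _ _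
      _ = ∑ Q ∈ 𝒬', (Pc 3).real (multiCross 3 2 m (k * m)) :=
          Finset.sum_congr rfl fun Q _ => hB2 3 2 m (k * m) (criticalProbI 3) (z Q)
      _ = 𝒬'.card * (Pc 3).real (multiCross 3 2 m (k * m)) := by rw [Finset.sum_const, nsmul_eq_mul]
      _ ≤ 726 * (k : ℝ) ^ 2 * (Pc 3).real (multiCross 3 2 m (k * m)) := by
          gcongr
      _ = 726 * ((k : ℝ) ^ 2 * (Pc 3).real (multiCross 3 2 m (k * m))) := by ring
      _ ≤ 726 * (1 / 1452) := by gcongr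
      _ = 1 / 2 := by norm_num
  have hM : 2 * 𝒬'.card ≤ 2 * (726 * k ^ 2) := by omega
  have hmono : (Pc 3).real (repEvent 3 (2 * (726 * k ^ 2)) n) ≤ (Pc 3).real (repEvent 3 (2 * 𝒬'.card) n) :=
    measureReal_mono (repEvent_antitone 3 n hM) (measure_ne_top _ _)
  rw [probReal_compl_eq_one_sub (measurableSet_repEvent 3 _ n)]
  linarith

/-- **The crux through the BULK sibling, modulo its stubs** (two provable, one open). -/
theorem NonProliferation_proof_bulk : NonProliferation :=
  NonProliferation_of_bulk stub_midSphereCrossers stub_multiCrossAt_shift stub_threeCrosserDecay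

/-! ## Gen 5 (lead c2): the RATIO DICHOTOMY — blocking at one fixed ratio along a subsequence ⇒ crux
(landed: `Theorems/PercNonProliferationNonProliferationRatioDichotomy.lean`, p124993) -/

/-- **`FrequentBlocking`** — the positive branch of the dichotomy. NOT a stub: it is, up to the spelling of
"infinitely often", the target `PercBudgetLadder.CritAnnulusBlockedIO` (stmt-CriticalPhenomena-5247) of a sibling
route, and it closes the summit on its own (`PercBudgetLadder.SufficesTarget` + `BlockingVanishesOfTheta`, both
proved). For some ratio `k ≥ 2` and `δ > 0`, for infinitely many `m`, the critical annulus `B(km) ∖ B(m)` of `ℤ³`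
carries no open path inside `B(km)` from `B(m)` to `∂ⁱⁿB(km)` with probability `≥ δ`. -/
def FrequentBlocking : Prop :=
  ∃ k : ℕ, 2 ≤ k ∧ ∃ δ : ℝ, 0 < δ ∧ ∃ᶠ m : ℕ in atTop,
    δ ≤ (bondPercolation (zdGraph 3) (criticalProbI 3)).real
      {ω | ¬ ∃ x ∈ box 3 m, ∃ y ∈ innerBoundary (zdGraph 3) (box 3 (k * m)),
        ω ∈ openConnIn (↑(box 3 (k * m)) : Set (Site 3)) x y}

/-- **Third composition (gen 5): `FrequentBlocking → crux`** (stated on the unfolded crux `∃ M c, 0 < c ∧ ∃ᶠ n, c ≤ P((repEvent 3 M n)ᶜ)`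
so that the skeleton's registered obligations stay exactly the two open stubs; the by-name version is the landed
`nonProliferation_of_frequently_blocked`) — BK at ratio `k` bounds the `(r+1)`-crosser
probability by `(1-δ)^{r+1}` at the blocked scales (`RatioDichotomy.real_multiCross_le_pow`), and the bulk
covering in frequently-form (`nonProliferation_of_frequently_multiCross`: mid-sphere grid `stub_boundaryGrid`,
`stub_midSphereCrossers` with multiplicity `r`, `stub_multiCrossAt_shift`, union bound) gives `M = 726 r k²`,
`c = 1/2` along `n = 2km + 2`. All landed (p124993). -/
theorem repEvent_compl_frequently_of_blocking (h : FrequentBlocking) :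
    ∃ (M : ℕ) (c : ℝ), 0 < c ∧ ∃ᶠ n : ℕ in atTop,
      c ≤ (bondPercolation (zdGraph 3) (criticalProbI 3)).real (repEvent 3 M n)ᶜ :=
  nonProliferation_iff.1
    (_root_.Summit.CriticalPhenomena.PercolationContinuityZ3.Theorems.NonProliferation.nonProliferation_of_frequently_blocked
      h)

/-- **The dichotomy read for the open stubs: if the crux fails, the critical annulus of `ℤ³` is crossed inside
`B(km)` with probability `→ 1` at EVERY fixed ratio `k ≥ 2`** (`crossing_tendsto_one_of_not_nonProliferation`,
landed). Hence `stub_boundaryCellTwoArm` / `stub_threeCrosserDecay` need only be proved in (and the disprover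
must first produce) the sure-crossing regime. -/
theorem sureCrossing_of_not_NonProliferation (h : ¬ NonProliferation) {k : ℕ} (hk : 2 ≤ k) :
    Tendsto (fun m : ℕ => (bondPercolation (zdGraph 3) (criticalProbI 3)).real
      {ω | ∃ x ∈ box 3 m, ∃ y ∈ innerBoundary (zdGraph 3) (box 3 (k * m)),
        ω ∈ openConnIn (↑(box 3 (k * m)) : Set (Site 3)) x y}) atTop (𝓝 1) :=
  _root_.Summit.CriticalPhenomena.PercolationContinuityZ3.Theorems.NonProliferation.crossing_tendsto_one_of_not_nonProliferation
    h hk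

/-! ## Calibration: the open stub is dimension-sensitive — its `d`-dimensional analogue gives the
`d`-dimensional crux by the same (dimension-free) bookkeeping, hence FAILS for `d ≥ 7` under (t-c) -/

/-- The `d`-dimensional analogue of the open stub: boundary two-distinct-cluster cell decay `o(ε^{d-1})`
(`= o(1/#cells)`, the free boundary of `B(2n) ⊆ ℤ^d` being `(d-1)`-dimensional). At `d = 3` it is the
registered stub verbatim (`boundaryCellTwoArmDim_three_iff`). -/
def BoundaryCellTwoArmDim (d : ℕ) : Prop :=
  ∀ δ : ℝ, 0 < δ → ∃ ε : ℝ, 0 < ε ∧ ε ≤ 1 ∧ ∃ᶠ n : ℕ in atTop,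
    ∀ Q : Finset (Site d), Q ⊆ innerBoundary (zdGraph d) (box d (2 * n)) →
      (∀ u ∈ Q, ∀ v ∈ Q, ∀ i : Fin d, ((|u i - v i| : ℤ) : ℝ) ≤ ε * n) →
      (bondPercolation (zdGraph d) (criticalProbI d)).real
        {ω | ∃ u ∈ Q, ∃ v ∈ Q, (∃ a ∈ box d n, ω ∈ openConnIn (↑(box d (2 * n)) : Set (Site d)) u a) ∧
          (∃ b ∈ box d n, ω ∈ openConnIn (↑(box d (2 * n)) : Set (Site d)) v b) ∧
          ω ∉ openConnIn (↑(box d (2 * n)) : Set (Site d)) u v} ≤ δ * ε ^ (d - 1)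

/-- At `d = 3` the `d`-dimensional statement IS the registered open stub. -/
theorem boundaryCellTwoArmDim_three_iff : BoundaryCellTwoArmDim 3 ↔ Stubs.stub_boundaryCellTwoArm :=
  Iff.rfl

/-- Arithmetic of the mesh in dimension `d`: if `ε ≤ 1`, `2 ≤ ε n` and `s = ⌊ε n⌋`, then
`2d (4n/s + 2)^{d-1} ≤ 2d·10^{d-1} / ε^{d-1}`. -/
theorem grid_count_le_dim (d : ℕ) {ε : ℝ} {n s : ℕ} (hε0 : 0 < ε) (hε1 : ε ≤ 1) (hn : 2 ≤ ε * n)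
    (hs : s = ⌊ε * n⌋₊) :
    2 * (d : ℝ) * (2 * ((2 * n : ℕ) : ℝ) / s + 2) ^ (d - 1) ≤ 2 * d * 10 ^ (d - 1) / ε ^ (d - 1) := by
  have hs_gt : ε * n - 1 < s := by rw [hs]; exact Nat.sub_one_lt_floor (ε * n)
  have hs_ge : ε * n / 2 ≤ s := by linarith
  have hs_pos : (0 : ℝ) < s := by linarith
  have h1 : 2 * ((2 * n : ℕ) : ℝ) / s ≤ 8 / ε := by
    rw [div_le_div_iff₀ hs_pos hε0]
    push_cast
    nlinarith
  have h2 : 2 * ((2 * n : ℕ) : ℝ) / s + 2 ≤ 10 / ε := by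
    have h3 : (2 : ℝ) ≤ 2 / ε := by
      rw [le_div_iff₀ hε0]; nlinarith
    have h4 : 8 / ε + 2 / ε = 10 / ε := by ring
    linarith
  have h0 : (0 : ℝ) ≤ 2 * ((2 * n : ℕ) : ℝ) / s + 2 := by positivity
  calc 2 * (d : ℝ) * (2 * ((2 * n : ℕ) : ℝ) / s + 2) ^ (d - 1)
      ≤ 2 * (d : ℝ) * (10 / ε) ^ (d - 1) := by gcongr
    _ = 2 * d * 10 ^ (d - 1) / ε ^ (d - 1) := by rw [div_pow]; ring

/-- **The dimension-free bookkeeping in every `d`**: `BoundaryCellTwoArmDim d` implies the `d`-dimensional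
crux `∃ M c, 0 < c ∧ ∃ᶠ n, c ≤ P_{p_c(ℤ^d)}((repEvent d M n)ᶜ)` (grid `stub_boundaryGrid`, pigeonhole/union
bound `stub_cellUnionBound`, both landed and valid in every dimension; `δ := 1/(2K+2)`,
`K := 2d·10^{d-1}`, `M := ⌊K/ε^{d-1}⌋`, `c = 1/2`). -/
theorem nonProliferationDim_of_boundaryCellTwoArmDim {d : ℕ} (h : BoundaryCellTwoArmDim d) :
    ∃ (M : ℕ) (c : ℝ), 0 < c ∧ ∃ᶠ n : ℕ in atTop,
      c ≤ (bondPercolation (zdGraph d) (criticalProbI d)).real (repEvent d M n)ᶜ := by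
  set K : ℝ := 2 * d * 10 ^ (d - 1) with hK
  have hK0 : 0 ≤ K := by positivity
  have hδ0 : (0 : ℝ) < 1 / (2 * K + 2) := by positivity
  obtain ⟨ε, hε0, hε1, hfreq⟩ := h (1 / (2 * K + 2)) hδ0
  have hεp : 0 < ε ^ (d - 1) := pow_pos hε0 _
  refine ⟨⌊K / ε ^ (d - 1)⌋₊, 1 / 2, by norm_num, ?_⟩
  have hev : ∀ᶠ n : ℕ in atTop, 2 ≤ ε * n := by
    refine (eventually_ge_atTop ⌈2 / ε⌉₊).mono fun n hn => ?_
    have h' : 2 / ε ≤ n := (Nat.le_ceil _).trans (by exact_mod_cast hn)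
    rwa [div_le_iff₀ hε0, mul_comm] at h'
  refine (hfreq.and_eventually hev).mono fun n hn => ?_
  obtain ⟨hQ, hn2⟩ := hn
  set s : ℕ := ⌊ε * n⌋₊ with hs
  have hs1 : 1 ≤ s := by
    rw [hs, Nat.one_le_floor_iff]; linarith
  obtain ⟨𝒬, hsub, hdiam, -, hcov, hcount⟩ := stub_boundaryGrid d (2 * n) s hs1
  have hs_le : (s : ℝ) ≤ ε * n := Nat.floor_le (by positivity)
  have hcell : ∀ Q ∈ 𝒬, (Pc d).real (faceTwoArm d n Q) ≤ 1 / (2 * K + 2) * ε ^ (d - 1) := by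
    intro Q hQ𝒬
    refine hQ Q (hsub Q hQ𝒬) fun u hu v hv i => ?_
    have h := hdiam Q hQ𝒬 u hu v hv i
    have h' : ((|u i - v i| : ℤ) : ℝ) + 1 ≤ s := by exact_mod_cast h
    linarith
  have hcountK : (𝒬.card : ℝ) ≤ K / ε ^ (d - 1) :=
    hcount.trans (grid_count_le_dim d hε0 hε1 hn2 hs)
  have hunion : (Pc d).real (repEvent d 𝒬.card n) ≤ 1 / 2 := by
    calc (Pc d).real (repEvent d 𝒬.card n)
        ≤ ∑ Q ∈ 𝒬, (Pc d).real (faceTwoArm d n Q) := stub_cellUnionBound d n (criticalProbI d) 𝒬 hcov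
      _ ≤ ∑ Q ∈ 𝒬, 1 / (2 * K + 2) * ε ^ (d - 1) := Finset.sum_le_sum hcell
      _ = 𝒬.card * (1 / (2 * K + 2) * ε ^ (d - 1)) := by rw [Finset.sum_const, nsmul_eq_mul]
      _ ≤ K / ε ^ (d - 1) * (1 / (2 * K + 2) * ε ^ (d - 1)) := by gcongr
      _ = K / (2 * K + 2) := by field_simp
      _ ≤ 1 / 2 := by
          rw [div_le_iff₀ (by positivity)]; linarith
  have hM : 𝒬.card ≤ ⌊K / ε ^ (d - 1)⌋₊ := Nat.le_floor hcountK
  have hmono : (Pc d).real (repEvent d ⌊K / ε ^ (d - 1)⌋₊ n) ≤ (Pc d).real (repEvent d 𝒬.card n) :=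
    measureReal_mono (repEvent_antitone d n hM) (measure_ne_top _ _)
  rw [probReal_compl_eq_one_sub (measurableSet_repEvent d _ n)]
  linarith

/-- **Calibration (barrier `SpanningClustersAboveSix` honoured formally).** For every `d ≥ 7` satisfying
Aizenman's two-point condition (t-c) with `η = 0`, the `d`-dimensional analogue of the open stub is FALSE
(`Negative.nonProliferation_false_of_twoPointBoundedRatio`: there `P(repEvent d M n) → 1` for every `M`). So any
proof of `stub_boundaryCellTwoArm` must use an input specific to low dimension — as
`Negative.nonProliferation_false_without_dimThree` demands of every sufficient condition for the crux. -/
theorem boundaryCellTwoArmDim_false_above_six {d : ℕ} [NeZero d] (hd : 6 < d)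
    (hτ : Literature.Barriers.CriticalPhenomena.TwoPointBoundedRatio d) : ¬ BoundaryCellTwoArmDim d :=
  fun h => nonProliferation_false_of_twoPointBoundedRatio hd hτ (nonProliferationDim_of_boundaryCellTwoArmDim h)

/-! ## The support theorem `PowerCap` from its three stubs and the grid (kernel-checked) -/

/-- `innerTwoArm` is measurable (finitely many `u, v, a, b`; `{x ↔ y in S}` is a cylinder event). -/
theorem measurableSet_innerTwoArm (d n : ℕ) (Q : Finset (Site d)) :
    MeasurableSet (innerTwoArm d n Q) := by
  refine measurableSet_setOf.2 (Measurable.exists fun u => measurable_const.and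
    (Measurable.exists fun v => measurable_const.and ((Measurable.exists fun a =>
      measurable_const.and ?_).and ((Measurable.exists fun b => measurable_const.and ?_).and
        (Measurable.not ?_)))))
  · exact (PlanarDuality.determinedBy_openConnIn (box d (2 * n)) u a).measurableSet_of_finset.mem
  · exact (PlanarDuality.determinedBy_openConnIn (box d (2 * n)) v b).measurableSet_of_finset.mem
  · exact (PlanarDuality.determinedBy_openConnIn (box d (2 * n)) u v).measurableSet_of_finset.mem

/-- **`PowerCap` from the stubs**: cells of side `s = ⌊n^{α/3}⌋` on `∂ⁱⁿB(n)` (`stub_boundaryGrid` at radius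
`n`), the deterministic count (`stub_innerCellCount`, a.e. since `P_{p_c}` is carried by lattice
configurations), the cell decay `P(innerTwoArm) ≤ n^{-α}` (`stub_innerTwoArmDecay`, `|cell| ≤ s³ ≤ n^α`) and
the layer cake (`stub_layerCake`) give `E N_n ≤ 2·#cells ≤ 432 n^{2 - 2α/3}` for `n ≥ n₁`; small `n` are
absorbed in the constant. -/
theorem powerCap_of (h2 : Stubs.stub_boundaryGrid) (h4 : Stubs.stub_innerCellCount)
    (h5 : Stubs.stub_innerTwoArmDecay) (h6 : Stubs.stub_layerCake) : PowerCap := by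
  obtain ⟨α₀, hα₀, n₁, hdec₀⟩ := h5 3 (by norm_num)
  set α : ℝ := min α₀ 1 with hα
  have hα0 : 0 < α := lt_min hα₀ one_pos
  have hα1 : α ≤ 1 := min_le_right _ _
  have hαle : α ≤ α₀ := min_le_left _ _
  -- the decay stub at the (possibly smaller) exponent `α ≤ 1`
  have hdec : ∀ n : ℕ, n₁ ≤ n → 1 ≤ n → ∀ Q : Finset (Site 3), Q ⊆ box 3 n →
      (∀ u ∈ Q, ∀ v ∈ Q, ∀ i : Fin 3, |u i - v i| ≤ ((⌊(n : ℝ) ^ α⌋₊ : ℕ) : ℤ)) →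
      (Pc 3).real (innerTwoArm 3 n Q) ≤ (n : ℝ) ^ (-α) := by
    intro n hn hn1 Q hQ hdiam
    have hn1' : (1 : ℝ) ≤ n := by exact_mod_cast hn1
    have hfl : ⌊(n : ℝ) ^ α⌋₊ ≤ ⌊(n : ℝ) ^ α₀⌋₊ :=
      Nat.floor_mono (Real.rpow_le_rpow_of_exponent_le hn1' hαle)
    have hfl' : ((⌊(n : ℝ) ^ α⌋₊ : ℕ) : ℤ) ≤ ((⌊(n : ℝ) ^ α₀⌋₊ : ℕ) : ℤ) := by exact_mod_cast hfl
    calc (Pc 3).real (innerTwoArm 3 n Q) ≤ (n : ℝ) ^ (-α₀) :=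
          hdec₀ n hn Q hQ fun u hu v hv i => (hdiam u hu v hv i).trans hfl'
      _ ≤ (n : ℝ) ^ (-α) := Real.rpow_le_rpow_of_exponent_le hn1' (by linarith)
  set n₂ : ℕ := max n₁ 1 with hn₂
  refine ⟨2 * α / 3, 432 + (2 * (n₂ : ℝ) + 1) ^ 3, by positivity, fun n hn => ?_⟩
  have hn0 : (0 : ℝ) < n := by exact_mod_cast hn
  have hn1 : (1 : ℝ) ≤ n := by exact_mod_cast hn
  have hβ2 : (0 : ℝ) ≤ 2 - 2 * α / 3 := by linarith
  have hpow1 : (1 : ℝ) ≤ (n : ℝ) ^ (2 - 2 * α / 3) := Real.one_le_rpow hn1 hβ2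
  have hC0 : (0 : ℝ) ≤ 432 + (2 * (n₂ : ℝ) + 1) ^ 3 := by positivity
  rcases Nat.lt_or_ge n n₂ with hlt | hge
  · -- small `n`: every term is `≤ 1`
    calc ∑ k ∈ Finset.range (box 3 n).card, (Pc 3).real (repEvent 3 k n)
        ≤ ∑ k ∈ Finset.range (box 3 n).card, (1 : ℝ) :=
          Finset.sum_le_sum fun k _ => measureReal_le_one
      _ = (2 * (n : ℝ) + 1) ^ 3 := by
          rw [Finset.sum_const, Finset.card_range, nsmul_eq_mul, mul_one, card_box]; push_cast; ring
      _ ≤ (2 * (n₂ : ℝ) + 1) ^ 3 := by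
          have hle : (n : ℝ) ≤ n₂ := by exact_mod_cast hlt.le
          gcongr
      _ ≤ (432 + (2 * (n₂ : ℝ) + 1) ^ 3) * 1 := by linarith
      _ ≤ (432 + (2 * (n₂ : ℝ) + 1) ^ 3) * (n : ℝ) ^ (2 - 2 * α / 3) := by gcongr
  · -- large `n`
    have hn₁ : n₁ ≤ n := le_trans (le_max_left _ _) hge
    set s : ℕ := ⌊(n : ℝ) ^ (α / 3)⌋₊ with hs
    have hnα3 : (1 : ℝ) ≤ (n : ℝ) ^ (α / 3) := Real.one_le_rpow hn1 (by positivity)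
    have hs1 : 1 ≤ s := by rw [hs, Nat.one_le_floor_iff]; exact hnα3
    have hs_pos : (0 : ℝ) < s := by exact_mod_cast hs1
    have hs_le : (s : ℝ) ≤ (n : ℝ) ^ (α / 3) := Nat.floor_le (by positivity)
    have hs_ge : (n : ℝ) ^ (α / 3) / 2 ≤ s := by
      have h1 : (n : ℝ) ^ (α / 3) - 1 < s := by rw [hs]; exact Nat.sub_one_lt_floor _
      have h2 : (1 : ℝ) ≤ s := by exact_mod_cast hs1
      by_cases h : (2 : ℝ) ≤ (n : ℝ) ^ (α / 3)
      · linarith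
      · linarith
    obtain ⟨𝒬, hsub, hdiam, hcardQ, hcov, hcount⟩ := h2 3 n s hs1
    -- `s³ ≤ n^α`
    have hs3 : (s : ℝ) ^ 3 ≤ (n : ℝ) ^ α := by
      calc (s : ℝ) ^ 3 ≤ ((n : ℝ) ^ (α / 3)) ^ 3 := by gcongr
        _ = (n : ℝ) ^ α := by
            rw [← Real.rpow_natCast, ← Real.rpow_mul hn0.le]; norm_num
    -- the cells fit the decay stub: coordinate-diameter `≤ s - 1 ≤ ⌊n^α⌋`
    have hsα : s ≤ ⌊(n : ℝ) ^ α⌋₊ := by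
      rw [hs]; exact Nat.floor_mono (Real.rpow_le_rpow_of_exponent_le hn1 (by linarith))
    have hdec' : ∀ Q ∈ 𝒬, (Pc 3).real (innerTwoArm 3 n Q) ≤ (n : ℝ) ^ (-α) := by
      intro Q hQ
      refine hdec n hn₁ hn Q (fun x hx => (mem_innerBoundary_iff.1 (hsub Q hQ hx)).1)
        fun u hu v hv i => ?_
      have h1 := hdiam Q hQ u hu v hv i
      have h2 : (s : ℤ) ≤ ((⌊(n : ℝ) ^ α⌋₊ : ℕ) : ℤ) := by exact_mod_cast hsα
      linarith
    -- layer cake with the deterministic count (a.e.: `P_{p_c}` lives on lattice configurations)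
    have hae : ∀ᵐ ω ∂(Pc 3), ∀ k < (box 3 n).card, ω ∈ repEvent 3 k n →
        (k + 1 : ℝ) ≤ 𝒬.card + ∑ Q ∈ 𝒬, (innerTwoArm 3 n Q).indicator (fun _ => (Q.card : ℝ)) ω := by
      filter_upwards [ae_subset_edgeSet (zdGraph 3) (criticalProbI 3)] with ω hω
      intro k _ hk
      exact h4 3 n k 𝒬 ω hn hω hcov hk
    have hLC := h6 3 (Pc 3) (box 3 n).card (fun k => repEvent 3 k n) 𝒬 (fun Q => innerTwoArm 3 n Q)
      𝒬.card (fun Q => (Q.card : ℝ)) (fun k => measurableSet_repEvent 3 k n)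
      (fun Q => measurableSet_innerTwoArm 3 n Q) (fun k k' hkk' => repEvent_antitone 3 n hkk')
      (Nat.cast_nonneg _) (fun Q => Nat.cast_nonneg _) hae
    -- the cell terms sum to at most `#cells`
    have hnα : (s : ℝ) ^ 3 * (n : ℝ) ^ (-α) ≤ 1 := by
      rw [Real.rpow_neg hn0.le, ← div_eq_mul_inv, div_le_one (Real.rpow_pos_of_pos hn0 _)]
      exact hs3
    have hcells : ∑ Q ∈ 𝒬, (Q.card : ℝ) * (Pc 3).real (innerTwoArm 3 n Q) ≤ 𝒬.card := by
      calc ∑ Q ∈ 𝒬, (Q.card : ℝ) * (Pc 3).real (innerTwoArm 3 n Q)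
          ≤ ∑ Q ∈ 𝒬, (s : ℝ) ^ 3 * (n : ℝ) ^ (-α) := by
            refine Finset.sum_le_sum fun Q hQ => ?_
            have hQ3 : (Q.card : ℝ) ≤ (s : ℝ) ^ 3 := by exact_mod_cast hcardQ Q hQ
            exact mul_le_mul hQ3 (hdec' Q hQ) measureReal_nonneg (by positivity)
        _ = 𝒬.card * ((s : ℝ) ^ 3 * (n : ℝ) ^ (-α)) := by rw [Finset.sum_const, nsmul_eq_mul]
        _ ≤ 𝒬.card * 1 := by gcongr
        _ = 𝒬.card := mul_one _
    -- the count: `#cells ≤ 6 (2n/s + 2)² ≤ 216 n^{2 - 2α/3}`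
    have hkey : (n : ℝ) ^ (1 - α / 3) * (n : ℝ) ^ (α / 3) = n := by
      rw [← Real.rpow_add hn0, show (1 - α / 3 + α / 3 : ℝ) = 1 by ring, Real.rpow_one]
    have hA0 : (0 : ℝ) ≤ (n : ℝ) ^ (1 - α / 3) := Real.rpow_nonneg hn0.le _
    have hA1 : (1 : ℝ) ≤ (n : ℝ) ^ (1 - α / 3) := Real.one_le_rpow hn1 (by linarith)
    have h1 : 2 * (n : ℝ) / s ≤ 4 * (n : ℝ) ^ (1 - α / 3) := by
      rw [div_le_iff₀ hs_pos]
      calc 2 * (n : ℝ) = 4 * (n : ℝ) ^ (1 - α / 3) * ((n : ℝ) ^ (α / 3) / 2) := by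
            rw [show 4 * (n : ℝ) ^ (1 - α / 3) * ((n : ℝ) ^ (α / 3) / 2)
              = 2 * ((n : ℝ) ^ (1 - α / 3) * (n : ℝ) ^ (α / 3)) by ring, hkey]
        _ ≤ 4 * (n : ℝ) ^ (1 - α / 3) * s := by gcongr
    have h2' : 2 * (n : ℝ) / s + 2 ≤ 6 * (n : ℝ) ^ (1 - α / 3) := by linarith
    have hsq : ((n : ℝ) ^ (1 - α / 3)) ^ 2 = (n : ℝ) ^ (2 - 2 * α / 3) := by
      rw [← Real.rpow_natCast, ← Real.rpow_mul hn0.le]; ring_nf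
    have hcount' : (𝒬.card : ℝ) ≤ 216 * (n : ℝ) ^ (2 - 2 * α / 3) := by
      have h0 : (0 : ℝ) ≤ 2 * (n : ℝ) / s + 2 := by positivity
      calc (𝒬.card : ℝ) ≤ 2 * (3 : ℕ) * (2 * (n : ℝ) / s + 2) ^ (3 - 1) := by exact_mod_cast hcount
        _ = 6 * (2 * (n : ℝ) / s + 2) ^ 2 := by norm_num
        _ ≤ 6 * (6 * (n : ℝ) ^ (1 - α / 3)) ^ 2 := by gcongr
        _ = 216 * (n : ℝ) ^ (2 - 2 * α / 3) := by rw [mul_pow, hsq]; ring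
    -- assemble
    calc ∑ k ∈ Finset.range (box 3 n).card, (Pc 3).real (repEvent 3 k n)
        ≤ 𝒬.card + ∑ Q ∈ 𝒬, (Q.card : ℝ) * (Pc 3).real (innerTwoArm 3 n Q) := hLC
      _ ≤ 𝒬.card + 𝒬.card := by linarith
      _ ≤ 432 * (n : ℝ) ^ (2 - 2 * α / 3) := by linarith
      _ ≤ (432 + (2 * (n₂ : ℝ) + 1) ^ 3) * (n : ℝ) ^ (2 - 2 * α / 3) := by
          gcongr; linarith [pow_nonneg (by positivity : (0 : ℝ) ≤ 2 * (n₂ : ℝ) + 1) 3]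

/-- **`PowerCap` — UNCONDITIONAL** (its four stubs have landed; standard axioms only). -/
theorem powerCap : PowerCap :=
  powerCap_of stub_boundaryGrid stub_innerCellCount stub_innerTwoArmDecay stub_layerCake

end Summit.CriticalPhenomena.PercolationContinuityZ3.Cruxes.NonProliferation.BoundaryPinning

end
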